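import Summits.BirchSwinnertonDyer.BirchSwinnertonDyer.Theorems.EisensteinPrimesMazurMCOnCellBTwistbackTwoStepIsogenyInvariance
import Summits.BirchSwinnertonDyer.BirchSwinnertonDyer.Theorems.EisensteinPrimesMazurMCOnCellBTwistbackSubrowPartnerAnyLinePAdicGZ
import Summits.BirchSwinnertonDyer.BirchSwinnertonDyer.Theorems.ByReductionTypeAtTwoOrdEisensteinHalfShaIsogeny
import Summits.BirchSwinnertonDyer.Rank1Residual.X2.IsogenyClassStability
import Literature.NumberTheory.EllipticCurves.TateCurve.NumberFieldUniformization
import Literature.NumberTheory.EllipticCurves.TateCurve.NumberFieldUniformizationTwisted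
import Literature.NumberTheory.EllipticCurves.AnalyticRankModularityProofs
import HarnessLib

/-!
# Crux 3 `MazurMCOnCellB` (stmt-BirchSwinnertonDyer-19033), line `twistback` v9 — the stub's (∃-PARTNER) CONCLUSION is
# constant on `ℚ`-isogeny classes; hence stub 6⁗ need be settled at ONE globally minimal member per class, and the
# sub-row derivation at ANY member of the class serves every member

Width seat bsd-line-x2-p1-w6 (gen 4), cell `bsd-eis`, 2026-08-28; `--supports stmt-BirchSwinnertonDyer-19033 --as helper`;
companion of the same seat's `…TwistbackTwoStepIsogenyInvariance` (p672105: the reachability datum of 6⁗ is a class datum).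
HONEST FRAMING: conditional theorems only — the named-fact hypotheses are conjuncts of the route's `PublishedInputs`
(modularity `nonempty_modularParametrizationData` / `exists_isNewformOf`, Cassels `bsdRHS_eq_of_isIsogenous`,
Gross–Zagier–Kolyvagin `rank_eq_analyticRank_of_analyticRank_le_one`) plus, in §3 only, the four PUBLISHED facts of the
sub-row theorem (Disegni Thm. 4(1), GV Thm. (3.11), Disegni Thm. 2.4, Nakagawa–Horie–Taya) exactly as labelled there; no
`def`, no named fact introduced, no `sorry`; closes no registered stub; no summit statement, no Mazur main conjecture and no
BSD is proved for any curve; 0 cells / labels / stubs / tiers move.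

WHY THIS FILE. The registered stub 6⁗ `stub_upperPartnerOffSubrowNoReachableClassShaUnit` (twistback v9, LEAD g14,
sha256 c4adf2f8…) is asked PER PAIR `(W, p)`: hypotheses `X2.CellB W p` (a class property: `X2.cellB_iff_of_isIsogenous`),
«`W` is NOT on the closed sub-row» (`p = 3`, non-split, a rational `3`-line datum of local balance one ON `W` — stated at the
member), «no Ш-unit class reachable from the class of `W`» (a class property by construction, and still one without its
`W₁` binder by p672105), and the conclusion = the (∃-PARTNER) clause at `(W, p)`: an admissible `K` (Heegner for `N_W` and
`p`, `d_K` odd `< −4`) with `ord_{s=1} L(E^{(d_K)}, s) = 1` and the upper half `ord_p #Ш ≤ ord_p #Ш_an` at every globally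
minimal model of `E^{(d_K)}`. §1 proves that this CONCLUSION transports along any `ℚ`-isogeny `W ∼ W'` of globally minimal
curves (`upperPartnerAt_of_isIsogenous`): the SAME field `K` serves `W'` — `N_{W'} = N_W` (modularity + Atkin–Lehner),
`r_an(W'^{(d_K)}) = r_an(W^{(d_K)})` (`IsIsogenous.quadraticTwist` + Knapp 11.67), and a minimal model `Wd'` of `W'^{(d_K)}` is
`ℚ`-isogenous to a minimal model `Wd` of `W^{(d_K)}`, both of analytic rank `1`, so the upper half moves from `Wd` to `Wd'`
by Cassels' invariance of the BSD quotient with `Ш(Wd)` finite (GZK) and `L'(Wd, 1) ≠ 0` (the tree's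
`EisensteinShaCurrency.missingUpperBoundAt_of_isIsogenous`, cell bsd-2adic). CONSEQUENCES (§2–§3): the three hypotheses and
the conclusion of 6⁗ being class data except the sub-row exclusion, **6⁗ holds at `(W, p)` as soon as its conclusion holds
at ONE globally minimal `W' ∼ W`** (`upperPartnerAt_of_exists_isIsogenous`), and in particular **as soon as SOME member
`W'` of the class is on the closed sub-row** (`upperPartnerAt_of_isIsogenous_onSubrow`, from x2-p1-w3 g11's PUBLISHED-only
sub-row theorem p661280 at `W'`): a later reshape may widen the first negation of 6⁗ from «`W` on the sub-row» to «some
`W' ∼ W` on the sub-row» at zero cost, and every per-pair (∃-PARTNER) display typed at one Cremona member (roads (b)/(c),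
x2-p1-w7's sub-row files) is a display for the whole isogeny class through x2-p1-w7 g3's kernel isogenies (p671549).

References: LEAD g14 v9 skeleton; x2-p1-w3 g11 p661280; x2-p1-w6 g4 p672105; x2-p1-w7 g3 p671549; cell bsd-2adic
`…ByReductionTypeAtTwoOrdEisensteinHalfShaIsogeny`; J. W. S. Cassels, J. reine angew. Math. 217 (1965) / J. S. Milne,
*ADT* Thm. I.7.3 [MilneADT2006]; A. W. Knapp, *Elliptic Curves* Thm. 11.67 [Knapp1993]; J. E. Cremona, *Algorithms* §3.9
[CremonaAlgorithms1997]; R. L. Miller, LMS J. Comput. Math. 14 (2011) Def. 1.1 [Miller2011LMS].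
-/

set_option autoImplicit false

-- `Summit.BirchSwinnertonDyer.BirchSwinnertonDyer.…`: the summit and its single sub-problem share a name.
set_option linter.dupNamespace false

noncomputable section

open scoped Classical MatrixGroups ModularForm NumberTheorySymbols

-- the `open` block of x2-p1-w3 g11's `…TwistbackSubrowPartnerAnyLinePAdicGZ` (so the sub-row datum of §3 parses
-- token-identically), plus the modularity namespace for `nonempty_modularParametrizationData`
open CongruenceSubgroup WeierstrassCurve NumberField IsDedekindDomain Field DirichletCharacter Rat.HeightOneSpectrum
  Literature.NumberTheory.EllipticCurves Literature.NumberTheory.GaloisRepresentations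
  Literature.NumberTheory.EllipticCurves.ModularForms Literature.NumberTheory.QuadraticFields
  Literature.NumberTheory.EllipticCurves.Rank1Residual Literature.NumberTheory.EllipticCurves.Rank1Residual.Typed
  Literature.NumberTheory.EllipticCurves.Wuthrich2014 Literature.NumberTheory.EllipticCurves.GreenbergVatsal2000
  Literature.NumberTheory.EllipticCurves.Disegni2020 Literature.NumberTheory.LFunctions
  Summit.BirchSwinnertonDyer.Rank1Residual Summit.BirchSwinnertonDyer.Rank1Residual.X2
  Summit.BirchSwinnertonDyer.BirchSwinnertonDyer.Theses
  Summit.BirchSwinnertonDyer.BirchSwinnertonDyer.Theorems.EisensteinPrimesLineWeilRelation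
  Summit.BirchSwinnertonDyer.BirchSwinnertonDyer.Theorems.EisensteinPrimesMazurMCOnCellBTwistbackKLFieldSupply
  Summit.BirchSwinnertonDyer.BirchSwinnertonDyer.Theorems.EisensteinPrimesMazurMCOnCellBTwistbackKLFieldSupplyClassNumber
  Summit.BirchSwinnertonDyer.BirchSwinnertonDyer.Theorems.EisensteinPrimesMazurMCOnCellBTwistbackPartnerClassNumberLift
  Summit.BirchSwinnertonDyer.BirchSwinnertonDyer.Theorems.EisensteinPrimesLinePsiAtMultiplicativePrime
  Summit.BirchSwinnertonDyer.BirchSwinnertonDyer.Theorems.EisensteinPrimesLinePhiAtMultiplicativePrime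
  Summit.BirchSwinnertonDyer.BirchSwinnertonDyer.Theorems.EisensteinPrimesMazurMCOnCellBTwistbackSubrowPartnerGiven
  Summit.BirchSwinnertonDyer.BirchSwinnertonDyer.Theorems.EisensteinPrimesMazurMCOnCellBTwistbackSubrowPartner
  Summit.BirchSwinnertonDyer.BirchSwinnertonDyer.Theorems.EisensteinPrimesMazurMCOnCellBTwistbackSubrowPartnerAnyLine
  Summit.BirchSwinnertonDyer.BirchSwinnertonDyer.Theorems.EisensteinPrimesMazurMCOnCellBTwistbackSubrowPartnerGivenPAdicGZ
  Summit.BirchSwinnertonDyer.Rank1Residual.X2.ResidualLineCharacters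
  Summit.BirchSwinnertonDyer.Rank1Residual.X2.ResidualLineCharactersOdd
  Summit.BirchSwinnertonDyer.Rank1Residual.X2.PrimeOrderCharacters
  Literature.NumberTheory.EllipticCurves.TateCurve

namespace Summit.BirchSwinnertonDyer.BirchSwinnertonDyer.Theorems.EisensteinPrimesMazurMCOnCellBTwistbackUpperPartnerIsogenyInvariance

/-! ## §1. The (∃-PARTNER) clause transports along a `ℚ`-isogeny -/

/-- **The (∃-PARTNER) conclusion of stub 6⁗ is constant on `ℚ`-isogeny classes.** For globally minimal elliptic
`W ∼ W'` over `ℚ` and a prime `p`: if some imaginary quadratic `K`, Heegner for `N_W` and for `p`, `d_K` odd `< −4`, has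
`ord_{s=1} L(W^{(d_K)}, s) = 1` and `ord_p #Ш(Wd) ≤ ord_p #Ш_an(Wd)` at every globally minimal model `Wd` of `W^{(d_K)}`, then
the SAME `K` does this for `W'`. Conductor along the isogeny by modularity (`hmodN`); analytic rank of the twist by
`IsIsogenous.quadraticTwist` (Cremona §3.9) and Knapp 11.67; the upper half moves between the isogenous rank-one minimal
models `Wd ∼ Wd'` by Cassels (`hCassels`) with `Ш(Wd)` finite (`hGZK`) and `L'(Wd,1) ≠ 0` (`hE`) —
`EisensteinShaCurrency.missingUpperBoundAt_of_isIsogenous`. Conditional on the four named facts as labelled (all conjuncts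
of / derived from `PublishedInputs`). [cite: MilneADT2006, Thm. I.7.3 and Remark I.7.4] -/
theorem upperPartnerAt_of_isIsogenous (hmodN : nonempty_modularParametrizationData)
    (hCassels : bsdRHS_eq_of_isIsogenous) (hGZK : rank_eq_analyticRank_of_analyticRank_le_one)
    (hE : WeierstrassCurve.hasEntireLFunction_rat)
    {p : ℕ} [Fact p.Prime] {W W' : WeierstrassCurve ℚ} [W.IsElliptic] [W.IsGloballyMinimal] [W'.IsElliptic]
    [W'.IsGloballyMinimal] (hiso : IsIsogenous W W')
    (h : ∃ (K : Type) (_ : Field K) (_ : NumberField K), IsImaginaryQuadratic K ∧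
      SatisfiesHeegnerHypothesis (W.conductorNorm ℤ) K ∧ SatisfiesHeegnerHypothesis p K ∧
      Odd (NumberField.discr K) ∧ NumberField.discr K < -4 ∧
      (W.quadraticTwist (NumberField.discr K : ℚ)).analyticRank = 1 ∧
      ∀ (Wd : WeierstrassCurve ℚ) [Wd.IsElliptic] [Wd.IsGloballyMinimal],
        (∃ C : VariableChange ℚ, C • Wd = W.quadraticTwist (NumberField.discr K : ℚ)) →
        MissingUpperBoundAt Wd p) :
    ∃ (K : Type) (_ : Field K) (_ : NumberField K), IsImaginaryQuadratic K ∧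
      SatisfiesHeegnerHypothesis (W'.conductorNorm ℤ) K ∧ SatisfiesHeegnerHypothesis p K ∧
      Odd (NumberField.discr K) ∧ NumberField.discr K < -4 ∧
      (W'.quadraticTwist (NumberField.discr K : ℚ)).analyticRank = 1 ∧
      ∀ (Wd : WeierstrassCurve ℚ) [Wd.IsElliptic] [Wd.IsGloballyMinimal],
        (∃ C : VariableChange ℚ, C • Wd = W'.quadraticTwist (NumberField.discr K : ℚ)) →
        MissingUpperBoundAt Wd p := by
  obtain ⟨K, _, _, hK, hHN, hHp, hodd, hlt, hr1, hU⟩ := h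
  have hdK : ((NumberField.discr K : ℤ) : ℚ) ≠ 0 := by exact_mod_cast (by omega : NumberField.discr K ≠ 0)
  have hN : W.conductorNorm ℤ = W'.conductorNorm ℤ :=
    conductorNorm_eq_of_isIsogenous_of_modularity_of_isGloballyMinimal hmodN hiso
  haveI := W.isElliptic_quadraticTwist hdK
  haveI := W'.isElliptic_quadraticTwist hdK
  -- the twists are isogenous in both directions
  have hisoK : IsIsogenous (W.quadraticTwist (NumberField.discr K : ℚ))
      (W'.quadraticTwist (NumberField.discr K : ℚ)) := hiso.quadraticTwist hdK
  have hisoK' : IsIsogenous (W'.quadraticTwist (NumberField.discr K : ℚ))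
      (W.quadraticTwist (NumberField.discr K : ℚ)) := hiso.symm_of_charZero.quadraticTwist hdK
  refine ⟨K, inferInstance, inferInstance, hK, by rw [← hN]; exact hHN, hHp, hodd, hlt,
    by rw [← analyticRank_eq_of_isIsogenous' hisoK]; exact hr1, ?_⟩
  intro Wd' _ _ hWd'
  obtain ⟨C', hC'⟩ := hWd'
  -- a globally minimal model `Wd` of `W^{(d_K)}`: the upper half holds there by hypothesis
  obtain ⟨Cm, hCm⟩ := hasGlobalMinimalModel_rat_holds (W.quadraticTwist (NumberField.discr K : ℚ))
  haveI := hCm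
  have hUd : MissingUpperBoundAt (Cm • W.quadraticTwist (NumberField.discr K : ℚ)) p :=
    hU (Cm • W.quadraticTwist (NumberField.discr K : ℚ)) ⟨Cm⁻¹, inv_smul_smul Cm _⟩
  -- `Wd' ∼ Wd`, both of analytic rank `1`
  have hdd : IsIsogenous Wd' (Cm • W.quadraticTwist (NumberField.discr K : ℚ)) :=
    (isIsogenous_of_smul_eq hC').trans' (hisoK'.trans' (isIsogenous_smul _ Cm))
  have hrd : (Cm • W.quadraticTwist (NumberField.discr K : ℚ)).analyticRank = 1 := by
    rw [analyticRank_eq_of_isIsogenous' (isIsogenous_of_smul (W.quadraticTwist (NumberField.discr K : ℚ)) Cm)]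
    exact hr1
  have hfin : Finite (Cm • W.quadraticTwist (NumberField.discr K : ℚ)).sha :=
    (hGZK (Cm • W.quadraticTwist (NumberField.discr K : ℚ)) (by rw [hrd])).2
  have hlead : (Cm • W.quadraticTwist (NumberField.discr K : ℚ)).leadingLCoeff ≠ 0 :=
    WeierstrassCurve.leadingLCoeff_ne_zero_holds (hE _)
  exact EisensteinShaCurrency.missingUpperBoundAt_of_isIsogenous hCassels hdd hfin hlead hUd

/-- **Iff form**: for globally minimal elliptic `W ∼ W'`, the (∃-PARTNER) clause holds at `(W, p)` iff it holds at
`(W', p)`. Conditional on the four named facts as labelled. [cite: MilneADT2006, Thm. I.7.3] -/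
theorem upperPartnerAt_iff_of_isIsogenous (hmodN : nonempty_modularParametrizationData)
    (hCassels : bsdRHS_eq_of_isIsogenous) (hGZK : rank_eq_analyticRank_of_analyticRank_le_one)
    (hE : WeierstrassCurve.hasEntireLFunction_rat)
    {p : ℕ} [Fact p.Prime] {W W' : WeierstrassCurve ℚ} [W.IsElliptic] [W.IsGloballyMinimal] [W'.IsElliptic]
    [W'.IsGloballyMinimal] (hiso : IsIsogenous W W') :
    (∃ (K : Type) (_ : Field K) (_ : NumberField K), IsImaginaryQuadratic K ∧
      SatisfiesHeegnerHypothesis (W.conductorNorm ℤ) K ∧ SatisfiesHeegnerHypothesis p K ∧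
      Odd (NumberField.discr K) ∧ NumberField.discr K < -4 ∧
      (W.quadraticTwist (NumberField.discr K : ℚ)).analyticRank = 1 ∧
      ∀ (Wd : WeierstrassCurve ℚ) [Wd.IsElliptic] [Wd.IsGloballyMinimal],
        (∃ C : VariableChange ℚ, C • Wd = W.quadraticTwist (NumberField.discr K : ℚ)) →
        MissingUpperBoundAt Wd p) ↔
    (∃ (K : Type) (_ : Field K) (_ : NumberField K), IsImaginaryQuadratic K ∧
      SatisfiesHeegnerHypothesis (W'.conductorNorm ℤ) K ∧ SatisfiesHeegnerHypothesis p K ∧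
      Odd (NumberField.discr K) ∧ NumberField.discr K < -4 ∧
      (W'.quadraticTwist (NumberField.discr K : ℚ)).analyticRank = 1 ∧
      ∀ (Wd : WeierstrassCurve ℚ) [Wd.IsElliptic] [Wd.IsGloballyMinimal],
        (∃ C : VariableChange ℚ, C • Wd = W'.quadraticTwist (NumberField.discr K : ℚ)) →
        MissingUpperBoundAt Wd p) :=
  ⟨upperPartnerAt_of_isIsogenous hmodN hCassels hGZK hE hiso,
    upperPartnerAt_of_isIsogenous hmodN hCassels hGZK hE hiso.symm_of_charZero⟩

/-! ## §2. Fed BY NAME from the route's `PublishedInputs` (the v9 cone's first stub) -/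

/-- **§1 with its four named facts read off `EisensteinPrimes.PublishedInputs`** (conjuncts 5 modularity, 2 Cassels,
11 GZK; `hasEntireLFunction_rat` from conjunct 6 `exists_isNewformOf`): the (∃-PARTNER) clause at `(W, p)` passes to
every globally minimal `W' ∼ W`. So STUB 6⁗ NEED BE SETTLED AT ONE MEMBER PER ISOGENY CLASS: its hypotheses `X2.CellB`
and «no reachable Ш-unit class» are class data already. Conditional on `hP`. [cite: MilneADT2006, Thm. I.7.3] -/
theorem upperPartnerAt_of_exists_isIsogenous (hP : EisensteinPrimes.PublishedInputs)
    {p : ℕ} [Fact p.Prime] {W : WeierstrassCurve ℚ} [W.IsElliptic] [W.IsGloballyMinimal]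
    (h : ∃ (W' : WeierstrassCurve ℚ) (_ : W'.IsElliptic) (_ : W'.IsGloballyMinimal), IsIsogenous W W' ∧
      ∃ (K : Type) (_ : Field K) (_ : NumberField K), IsImaginaryQuadratic K ∧
        SatisfiesHeegnerHypothesis (W'.conductorNorm ℤ) K ∧ SatisfiesHeegnerHypothesis p K ∧
        Odd (NumberField.discr K) ∧ NumberField.discr K < -4 ∧
        (W'.quadraticTwist (NumberField.discr K : ℚ)).analyticRank = 1 ∧
        ∀ (Wd : WeierstrassCurve ℚ) [Wd.IsElliptic] [Wd.IsGloballyMinimal],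
          (∃ C : VariableChange ℚ, C • Wd = W'.quadraticTwist (NumberField.discr K : ℚ)) →
          MissingUpperBoundAt Wd p) :
    ∃ (K : Type) (_ : Field K) (_ : NumberField K), IsImaginaryQuadratic K ∧
      SatisfiesHeegnerHypothesis (W.conductorNorm ℤ) K ∧ SatisfiesHeegnerHypothesis p K ∧
      Odd (NumberField.discr K) ∧ NumberField.discr K < -4 ∧
      (W.quadraticTwist (NumberField.discr K : ℚ)).analyticRank = 1 ∧
      ∀ (Wd : WeierstrassCurve ℚ) [Wd.IsElliptic] [Wd.IsGloballyMinimal],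
        (∃ C : VariableChange ℚ, C • Wd = W.quadraticTwist (NumberField.discr K : ℚ)) →
        MissingUpperBoundAt Wd p := by
  obtain ⟨W', _, _, hiso, hK⟩ := h
  exact upperPartnerAt_of_isIsogenous hP.2.2.2.2.1 hP.2.1 hP.2.2.2.2.2.2.2.2.2.2.1
    (WeierstrassCurve.hasEntireLFunction_rat_of_exists_isNewformOf hP.2.2.2.2.2.1) hiso.symm_of_charZero hK

/-! ## §3. The closed sub-row serves the whole isogeny class -/

/-- **If SOME globally minimal `W' ∼ W` lies on the closed sub-row, the (∃-PARTNER) clause holds at `(W, 3)`** — PUBLISHED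
inputs only: `X2.CellB` moves to `W'` (`X2.cellB_iff_of_isIsogenous`, Tate uniformisation discharged in the tree),
x2-p1-w3 g11's `…SubrowPartnerAnyLinePAdicGZ.upperPartner_at_three_of_balanceOne_of_padicGZ` (p661280) gives the clause at
`(W', 3)` from the balance-one rational `3`-line datum ON `W'`, and §2 carries it back to `W`. So the first negated
hypothesis of stub 6⁗ («`W` itself is not on the sub-row») may be widened to «no `W' ∼ W` is on the sub-row» in a later
reshape with the difference DERIVED. Named facts BY NAME exactly as in p661280: `hP`, Disegni Thm. 4(1) `hDis`, GV Thm.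
(3.11) `h311`, Disegni Thm. 2.4 `hDGZ`, Nakagawa–Horie–Taya `hNH` — all PUBLISHED. [cite: Disegni2020, §2.2 Thm. 2.4 and §3.2 Thm. 4]
[cite: GreenbergVatsal2000, §3 Thm. (3.11)] [cite: NakagawaHorie1988, Thm. 1] [cite: MilneADT2006, Thm. I.7.3] -/
theorem upperPartnerAt_of_isIsogenous_onSubrow (hP : EisensteinPrimes.PublishedInputs)
    (hDis : padicBSD_rankOne_nonsplitMult) (h311 : thm311_hasUnitContent_iff_and_order_eq_of_lineRamifiedEven)
    (hDGZ : padicGrossZagier_nonsplitMult)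
    (hNH : Literature.NumberTheory.QuadraticFields.nakagawaHorie_taya_exists_imaginary_h3_eq_one)
    [Fact (Nat.Prime 3)] (W : WeierstrassCurve ℚ) [W.IsElliptic] [W.IsGloballyMinimal] (hc : X2.CellB W 3)
    (W' : WeierstrassCurve ℚ) [W'.IsElliptic] [W'.IsGloballyMinimal] (hiso : IsIsogenous W W')
    (hns : ¬ W'.HasSplitMultiplicativeReductionAtPrime 3)
    (hbal : ∃ (Φ₀ : AddSubgroup (geomTorsion W' (3 : ℤ))) (m : ℕ) (_ : NeZero m) (φ : DirichletCharacter (ZMod 3) m)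
        (d : ℕ) (_ : NeZero d) (ψ : DirichletCharacter (ZMod 3) d) (S₀ : Finset (HeightOneSpectrum (𝓞 ℚ))),
      IsRationalLine W' 3 Φ₀ ∧ φ.IsPrimitive ∧ ψ.IsPrimitive ∧
      (∀ (σ : absoluteGaloisGroup ℚ), ∀ P ∈ Φ₀,
        σ • P = (φ ((modNCyclotomicCharacter ℚ m σ : (ZMod m)ˣ) : ZMod m)).val • P) ∧
      (∀ (σ : absoluteGaloisGroup ℚ) (P : geomTorsion W' (3 : ℤ)),
        σ • P - (ψ ((modNCyclotomicCharacter ℚ d σ : (ZMod d)ˣ) : ZMod d)).val • P ∈ Φ₀) ∧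
      (∀ v ∈ S₀, ((3 : ℕ) : 𝓞 ℚ) ∉ v.asIdeal) ∧
      (∀ v : HeightOneSpectrum (𝓞 ℚ), v ∉ S₀ → ((3 : ℕ) : 𝓞 ℚ) ∉ v.asIdeal → W'.HasGoodReductionAt v) ∧
      1 + ∑ v ∈ S₀, delta W' 3 v =
        ∑ v ∈ S₀, ((if φ (Rat.HeightOneSpectrum.natGenerator v : ZMod m) =
              (Rat.HeightOneSpectrum.natGenerator v : ZMod 3)
            then sFactor 3 (Rat.HeightOneSpectrum.natGenerator v) else 0) +
          (if ψ (Rat.HeightOneSpectrum.natGenerator v : ZMod d) =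
              (Rat.HeightOneSpectrum.natGenerator v : ZMod 3)
            then sFactor 3 (Rat.HeightOneSpectrum.natGenerator v) else 0))) :
    ∃ (K : Type) (_ : Field K) (_ : NumberField K), IsImaginaryQuadratic K ∧
      SatisfiesHeegnerHypothesis (W.conductorNorm ℤ) K ∧ SatisfiesHeegnerHypothesis 3 K ∧
      Odd (NumberField.discr K) ∧ NumberField.discr K < -4 ∧
      (W.quadraticTwist (NumberField.discr K : ℚ)).analyticRank = 1 ∧
      ∀ (Wd : WeierstrassCurve ℚ) [Wd.IsElliptic] [Wd.IsGloballyMinimal],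
        (∃ C : VariableChange ℚ, C • Wd = W.quadraticTwist (NumberField.discr K : ℚ)) →
        MissingUpperBoundAt Wd 3 := by
  have hc' : X2.CellB W' 3 :=
    (X2.cellB_iff_of_isIsogenous (p := 3) TateCurve.Silverman1994_thmV53_tateUniformisation_holds
      TateCurve.Silverman1994_thmV53_corV54_tateUniformisation_holds hiso).mp hc
  exact upperPartnerAt_of_exists_isIsogenous hP ⟨W', inferInstance, inferInstance, hiso,
    EisensteinPrimesMazurMCOnCellBTwistbackSubrowPartnerAnyLinePAdicGZ.upperPartner_at_three_of_balanceOne_of_padicGZ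
      hP hDis h311 hDGZ hNH W' hc' hns hbal⟩

end Summit.BirchSwinnertonDyer.BirchSwinnertonDyer.Theorems.EisensteinPrimesMazurMCOnCellBTwistbackUpperPartnerIsogenyInvariance

end
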